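/-
Copyright (c) 2026 the pub-hodgecm-mathlib formalisation cell (harness21).  Prover seat hodgecm-mathlib-LH4-p16 (g2), req620 Track A «(D-RAM) FOUR-FRAME» squad
(STAGE-1b, row (2) of the piece `f_{T₊}`, the (β₂) road (R-36); β₂ sub-dealer LH4-p04 (g9) «OFF-ROW ZERO + ROW», lane-C hinge LH7-p10 (g2); MECH-K1 v1 §1
«every row vertex is labelled»), 2026-09-04.
-/
import Summits.HodgeConjecture.HodgeConjecture.Theorems.F0P3cDyRamNearCellFlippedLetter     -- ★ p862581 (this seat): brings ★ p861372 HEAD B, ★ p861653 `normFormSet_eq_ray_of_isOrd`, ★ p862206 (S0″), ★ `v_map_le_pow_iff`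
import Summits.HodgeConjecture.HodgeConjecture.Theorems.F0P3cDyRamCleanELetterRamM         -- ★ p862630 (this seat) §1: `exists_fixed_unit_sub_mul_refSkew_le_any` (Eisenstein coordinates, ANY parity)
import HarnessLib

/-!
# Crux `H413`, line LH4 «(D-RAM) FOUR-FRAME» — STAGE-1b, row (2), the (β₂) road (R-36), the live row, ANY cell, ANY lane: «THE RAY SCALAR OF A ROW VERTEX IS NEARLY `σ`-FIXED»

Cell `hodgecm-mathlib` (D-0151), FLOOR 0, crux item H413 = `stmt-HodgeConjecture-24833`, route of record `HCCMUnconditional`; squad F0∕P3c∕LH4; lane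
`--supports stmt-HodgeConjecture-24833 --as helper` (count-neutral; pays NO tier-0 row).  THEOREMS ONLY (no `def`, no instance, no notation, no `sorry`, default heartbeats);
★-only imports; states NO law; (β₂) stays a HYPOTHESIS.  DATUM-FREE: §1 is ring algebra on the line model `(M, jE, ρ, Θ; lam, u)`, §2 valuation algebra, §3 the `E`-side
transport; §4 is ★ p861372 HEAD B's frame + ★ p861653's ray-domination letters + the sheet datum on `E`, as in ★ p862581 HEAD′, with the clean∕flip letters REPLACED by
three deep tokens and the population token — so it covers the CLEAN, the FLIP and the INTERMEDIATE cells of the live row at once (MECH-K1 v1 §2, `F0/P3c/LH4/LH4-p16/g2/`).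
WHY.  By ★ p861653 the census letter of an integral glued vertex over an order cell is the thickened ray of ONE scalar `g = e₀∕t₊`, `jE e₀ = Tr_ρ(μ∕D₀)`, `μ = lam − jE u₀₀`,
`D₀ = cc(α − ρα)·ΘY`, `Y = dualGen` (★ DEFS); ★ p862581 reads `g` against the reference unit `e` in the CLEAN (`|g − e| ≤ |ϖ|^{2d−1}`) and FLIP regimes.  In the
INTERMEDIATE regime `|g − e| = |ϖ|^k`, `1 ≤ k ≤ 2d − 3`, and (S0″) needs SOME `σ`-fixed unit `e′` with `|g − e′| ≤ |ϖ|^{2d−1}` — which exists iff `g` is `σ`-fixed to `3d − 2`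
digits (Eisenstein coordinates, ★ p862630 §1).  THIS FILE proves that from the STRUCTURE of the line model, not from sizes of pieces:
* §1 `Θlam·lam = 1`, `u·σu = 1`, `Θ∘jE = jE∘σ` give `Θμ·(lam·jE u) = −μ` (`theta_depth_mul`), hence the exact identity
  `jE(e₀ + u·σe₀) = Tr_ρ(μ·(1 − lam⁻¹)∕D₀)` (`map_add_mul_map_eq`); and `D₀ = Y·Θcc·Θ(α − ρα)` (`cellScalar_eq_dualGen_mul`) with `Θ(α − ρα)` ANTI-`ρ`-fixed, so
  `Tr_ρ(W∕(Θcc·Θ(α − ρα))) = (W − ρW)∕(Θcc·Θ(α − ρα))`, `W := (μ∕Y)·(1 − lam⁻¹)` (`add_map_div_eq_sub_map_div`): the trace of a nearly ANTI-fixed element is its SKEW part;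
* §2 the population token `μ∕Y ∈ 𝒪_cc` (★ DEFS `forall_herm_mul_mem_iff_isOrd_div`) bounds `|μ∕Y − ρ(μ∕Y)| ≤ |cc(α − ρα)|`, and `|(1 − lam⁻¹) − ρ(1 − lam⁻¹)| = |lam − ρlam|`:
  `|jE(e₀ + u·σe₀)| ≤ max(|lam − 1|, |μ∕Y|·|lam − ρlam|∕|cc(α − ρα)|)` (`v_map_add_mul_map_le`) — in tokens `|jEϖ|^{min(N, m_E + jl − j − b)}` (`v_skew_le_of_tokens`), tiny on
  every cell up to the terminal line;
* §3 transport to `E` and `|e₀ + σe₀| ≤ max(|e₀ + uσe₀|, |u − 1|·|e₀|)`; the row reading `|e₀| = |ϖ|^{d%2}` from the glue letters (`v_rayScalar_eq_of_row`);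
* §4 HEAD `exists_fixed_unit_valueSet_endoGL_sub_one_glued_eq_smul_xPlus`: ∃ `σ`-fixed unit `e′`, `|e₀ − e′·t₊| ≤ |ϖ|^{m*}` AND `VS_{m*}(Γ − 1 | L) = valueSetMod σ ϖ m* (e′ • X₊)` —
  EVERY non-terminal vertex of the live row is labelled, by `ω(e′)`; with ★ p862871 `rayScalar_eq_affine` (`e₀ = pw·(μ_a + μ_b(R₀ + V·γ₀))`) and ★-cand `…AffineLabelAnyParity`
  the label is `ω(T)·ω(α₁ + γ₁·V(Λ))`, affine in the cell coordinate `V(Λ)` — the input of LH4-p19 (g2)'s digit balance ★ p862655 for the INTERMEDIATE cells of BOTH lanes.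
WHAT IS NOT CLAIMED: the distribution of `V(Λ)` over a cell (K5), any census identity, sizes, the terminal line (`|e₀| < |t₊|`, LH7-p09 (g2)), `q ≥ 4` specifics (none used).
HONEST LABEL.  Count-neutral valuation ∕ lattice algebra; nothing printed is asserted; no census law is stated; `HC_CM` is proved only modulo the 7 printed citations (2 remaining
named inputs: hLiu418 = `stmt-HodgeConjecture-24832`, h413 = `stmt-HodgeConjecture-24833`) until rung 0 closes.
## References
* [Serre1979] J.-P. Serre, *Local Fields*, GTM 67 (1979): Ch. I §6 Prop. 18, Ch. III §3 Prop. 7, §6 Prop. 12, Ch. V §3 Cor. 3; [Jacobowitz1962] R. Jacobowitz, *Hermitian forms over local fields*,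
  Amer. J. Math. 84 (1962): §4; [Rogawski1990] J. D. Rogawski, *Automorphic Representations of Unitary Groups in Three Variables*, Ann. of Math. Stud. 123 (1990): §4.9 Prop. 4.9.1 (b) p. 55.
* [Kottwitz1986BaseChangeUnits] R. E. Kottwitz, *Base change for unit elements of Hecke algebras*, Compositio Math. 60 (1986): §1 pp. 240–241.
-/

set_option autoImplicit false

noncomputable section

namespace Summit.HodgeConjecture.HodgeConjecture.Cruxes.H413.F0P3cDyRamRayScalarNearlyFixed

open scoped Valued WithZero Matrix MatrixGroups
open WithZero
open Literature.NumberTheory.Automorphic Literature.NumberTheory.Automorphic.HermitianLattice Literature.NumberTheory.Automorphic.UnitaryLatticeTree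
open Literature.NumberTheory.Automorphic.UnitaryThreeFourFrame (IsRamifiedQuadraticDatum)
open Literature.NumberTheory.Rogawski1990
open Summit.HodgeConjecture.HodgeConjecture.Cruxes.H413.F0P3cDyRamFourFramePieces
open Summit.HodgeConjecture.HodgeConjecture.Cruxes.H413.F0P3cDyRamToricCensusDefs
open Summit.HodgeConjecture.HodgeConjecture.Cruxes.H413.F0P3cDyRamDepthFormLineModel (valueSet_endoGL_sub_one_glued_eq_normFormSet_of_gen)
open Summit.HodgeConjecture.HodgeConjecture.Cruxes.H413.F0P3cDyRamNormFormRayDominated (normFormSet_eq_ray_of_isOrd)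
open Summit.HodgeConjecture.HodgeConjecture.Cruxes.H413.F0P3cDyRamLabelShellFlipCardTwo (v_refSkew_eq valueSetMod_smul_xPlus_eq_of_v_sub_le_pred)
open Summit.HodgeConjecture.HodgeConjecture.Cruxes.H413.F0P3cDyRamDiagonalCellCleanRegime (v_map_le_pow_iff)
open Summit.HodgeConjecture.HodgeConjecture.Cruxes.H413.F0P3cDyRamCleanELetterRamM (exists_fixed_unit_sub_mul_refSkew_le_any)

variable {E M : Type} [Field E] [Valued E ℤᵐ⁰] [Field M] [Valued M ℤᵐ⁰] {ρ Θ : M →+* M} {α : M}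

/-! ## §1 Ring algebra on the line model: `Θμ·(lam·jE u) = −μ`, the exact identity for `e₀ + u·σe₀`, the cell scalar, the trace of a nearly anti-fixed element -/

omit [Valued E ℤᵐ⁰] [Valued M ℤᵐ⁰] in
/-- **THE `Θ`-CONJUGATE OF THE DEPTH MULTIPLIER**: `Θlam·lam = 1`, `u·σu = 1`, `Θ∘jE = jE∘σ` ⟹ `Θ(lam − jE u)·(lam·jE u) = −(lam − jE u)`. [cite: Rogawski1990, §4.9 Prop. 4.9.1 (b) p. 55] -/
theorem theta_depth_mul (σ : E →+* E) (jE : E →+* M) (hΘj : ∀ c, Θ (jE c) = jE (σ c)) {lam : M} {u : E}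
    (hΘlam : Θ lam * lam = 1) (huu : u * σ u = 1) :
    Θ (lam - jE u) * (lam * jE u) = -(lam - jE u) := by
  have h1 : jE u * jE (σ u) = 1 := by rw [← map_mul, huu, map_one]
  rw [map_sub, hΘj]
  linear_combination (jE u) * hΘlam - lam * h1

omit [Valued E ℤᵐ⁰] [Valued M ℤᵐ⁰] in
/-- **THE EXACT IDENTITY FOR `e₀ + u·σe₀`**: with `ΘD₀ = D₀ ≠ 0`, `Θρ = ρΘ`, `ρ∘jE = jE` and `jE e₀ = Tr_ρ(μ∕D₀)`, `μ = lam − jE u`: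
`jE(e₀ + u·σe₀) = Tr_ρ(μ·(1 − lam⁻¹)∕D₀)` (since `jE σe₀ = Tr_ρ(Θμ∕D₀)` and `jE u·Θμ = −μ∕lam`). [cite: Rogawski1990, §4.9 Prop. 4.9.1 (b) p. 55] [cite: Jacobowitz1962, §4] -/
theorem map_add_mul_map_eq (σ : E →+* E) (jE : E →+* M) (hΘj : ∀ c, Θ (jE c) = jE (σ c)) (hρj : ∀ c, ρ (jE c) = jE c)
    (hΘρ : ∀ x, Θ (ρ x) = ρ (Θ x)) {lam D₀ : M} {u e₀ : E} (hΘlam : Θ lam * lam = 1) (huu : u * σ u = 1) (hD : Θ D₀ = D₀) (hD0 : D₀ ≠ 0)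
    (he₀ : jE e₀ = (lam - jE u) / D₀ + ρ ((lam - jE u) / D₀)) :
    jE (e₀ + u * σ e₀) = (lam - jE u) * (1 - lam⁻¹) / D₀ + ρ ((lam - jE u) * (1 - lam⁻¹) / D₀) := by
  have hlam0 : lam ≠ 0 := fun h0 => by rw [h0, mul_zero] at hΘlam; exact zero_ne_one hΘlam
  have hu0 : u ≠ 0 := fun h0 => by rw [h0, zero_mul] at huu; exact zero_ne_one huu
  have hju0 : jE u ≠ 0 := (map_ne_zero jE).2 hu0
  have hσe : jE (σ e₀) = Θ (lam - jE u) / D₀ + ρ (Θ (lam - jE u) / D₀) := by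
    rw [← hΘj, he₀, map_add, hΘρ, map_div₀, hD]
  have hΘμ : Θ (lam - jE u) = -(lam - jE u) / (lam * jE u) :=
    eq_div_of_mul_eq (mul_ne_zero hlam0 hju0) (theta_depth_mul σ jE hΘj hΘlam huu)
  have key : (lam - jE u) / D₀ + jE u * (Θ (lam - jE u) / D₀) = (lam - jE u) * (1 - lam⁻¹) / D₀ := by
    rw [hΘμ]; field_simp; ring
  calc jE (e₀ + u * σ e₀) = jE e₀ + jE u * jE (σ e₀) := by rw [map_add, map_mul]
    _ = ((lam - jE u) / D₀ + jE u * (Θ (lam - jE u) / D₀)) + ρ ((lam - jE u) / D₀ + jE u * (Θ (lam - jE u) / D₀)) := by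
        rw [he₀, hσe, map_add ρ, map_mul ρ (jE u), hρj]; ring
    _ = _ := by rw [key]

omit [Valued M ℤᵐ⁰] in
/-- **THE CELL SCALAR THROUGH THE DUAL GENERATOR**: `Θh = h`, `Θ² = 1` ⟹ `cc(α − ρα)·Θ(Y) = Y·(Θcc·Θ(α − ρα))`, `Y = dualGen ρ Θ α cc h x₀ = h·N_Θ(x₀)·cc(α − ρα)` (so
`D₀ = cc(α − ρα)·ΘY` is `Y` times a `ρ`-fixed unit times an ANTI-`ρ`-fixed scalar). [cite: Jacobowitz1962, §4] -/
theorem cellScalar_eq_dualGen_mul (hΘΘ : ∀ x, Θ (Θ x) = x) {hM : M} (hΘh : Θ hM = hM) (cc x₀ : M) :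
    cc * (α - ρ α) * Θ (dualGen ρ Θ α cc hM x₀) = dualGen ρ Θ α cc hM x₀ * (Θ cc * Θ (α - ρ α)) := by
  rw [dualGen_def]; simp only [map_mul, hΘΘ, hΘh]; ring

omit [Valued M ℤᵐ⁰] in
/-- **THE TRACE OF A QUOTIENT BY AN ANTI-FIXED SCALAR IS THE SKEW PART**: `ρc′ = c′`, `ρA = −A` ⟹ `W∕(c′A) + ρ(W∕(c′A)) = (W − ρW)∕(c′A)`. [cite: Serre1979, Ch. III §3 Prop. 7] -/
theorem add_map_div_eq_sub_map_div (ρ : M →+* M) {c' A : M} (hc : ρ c' = c') (hA : ρ A = -A) (W : M) :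
    W / (c' * A) + ρ (W / (c' * A)) = (W - ρ W) / (c' * A) := by
  rw [map_div₀, map_mul, hc, hA, mul_neg, div_neg, ← sub_eq_add_neg, ← sub_div]

omit [Valued M ℤᵐ⁰] in
/-- The skew part of a product: `PV − ρ(PV) = (P − ρP)·V + ρP·(V − ρV)`. [cite: Serre1979, Ch. III §3 Prop. 7] -/
theorem mul_sub_map_mul_eq (ρ : M →+* M) (P V : M) : P * V - ρ (P * V) = (P - ρ P) * V + ρ P * (V - ρ V) := by
  rw [map_mul]; ring

omit [Valued M ℤᵐ⁰] in
/-- The skew part of `1 − lam⁻¹` is `(lam − ρlam)∕(lam·ρlam)` (`lam ≠ 0`). [cite: Serre1979, Ch. III §3 Prop. 7] -/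
theorem one_sub_inv_sub_map_eq (ρ : M →+* M) {lam : M} (hlam0 : lam ≠ 0) :
    (1 - lam⁻¹) - ρ (1 - lam⁻¹) = (lam - ρ lam) / (lam * ρ lam) := by
  have hρ0 : ρ lam ≠ 0 := (map_ne_zero ρ).2 hlam0
  rw [map_sub, map_one, map_inv₀]; field_simp; ring

/-! ## §2 Valuations: the population token bounds the skew of `μ∕Y`, and the trace identity bounds `|jE(e₀ + u·σe₀)|` -/

omit [Valued E ℤᵐ⁰] in
/-- **THE `M`-SIDE LETTER — `|jE(e₀ + u·σe₀)| ≤ max(|lam − 1|, |μ∕Y|·|lam − ρlam|∕|cc(α − ρα)|)`.**  Line-model letters (`ρ`, `Θ` commuting involutive isometries, `ρ∘jE = jE`,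
`Θ∘jE = jE∘σ`, `Θh = h ≠ 0`, `x₀ ≠ 0`, `ρcc = cc`, `cc(α − ρα) ≠ 0`), `Θlam·lam = 1`, `|lam| = 1`, `u·σu = 1`, the POPULATION token `μ∕Y ∈ 𝒪_cc` (`IsOrd ρ α cc (μ∕Y)`,
`Y = dualGen ρ Θ α cc h x₀`; ★ DEFS `forall_herm_mul_mem_iff_isOrd_div`) and `jE e₀ = Tr_ρ(μ∕D₀)`, `D₀ = cc(α − ρα)·ΘY`, `μ = lam − jE u`.
[cite: Jacobowitz1962, §4] [cite: Kottwitz1986BaseChangeUnits, §1 pp. 240–241] [cite: Serre1979, Ch. III §3 Prop. 7] -/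
theorem v_map_add_mul_map_le (σ : E →+* E) (jE : E →+* M) (hΘj : ∀ c, Θ (jE c) = jE (σ c)) (hρj : ∀ c, ρ (jE c) = jE c)
    (hρρ : ∀ x, ρ (ρ x) = x) (hvρ : ∀ x, Valued.v (ρ x) = Valued.v x) (hΘΘ : ∀ x, Θ (Θ x) = x) (hΘρ : ∀ x, Θ (ρ x) = ρ (Θ x)) (hvΘ : ∀ x, Valued.v (Θ x) = Valued.v x)
    {cc hM x₀ lam : M} (hc : ρ cc = cc) (hcc : cc * (α - ρ α) ≠ 0) (hhM : hM ≠ 0) (hΘh : Θ hM = hM) (hx₀ : x₀ ≠ 0)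
    (hΘlam : Θ lam * lam = 1) (hvlam : Valued.v lam = 1) {u e₀ : E} (huu : u * σ u = 1)
    (hP : IsOrd ρ α cc ((lam - jE u) / dualGen ρ Θ α cc hM x₀))
    (he₀ : jE e₀ = (lam - jE u) / (cc * (α - ρ α) * Θ (dualGen ρ Θ α cc hM x₀)) + ρ ((lam - jE u) / (cc * (α - ρ α) * Θ (dualGen ρ Θ α cc hM x₀)))) :
    Valued.v (jE (e₀ + u * σ e₀)) ≤
      max (Valued.v (lam - 1)) (Valued.v ((lam - jE u) / dualGen ρ Θ α cc hM x₀) * Valued.v (lam - ρ lam) / Valued.v (cc * (α - ρ α))) := by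
  set Y : M := dualGen ρ Θ α cc hM x₀ with hYdef
  have hlam0 : lam ≠ 0 := fun h0 => by rw [h0, mul_zero] at hΘlam; exact zero_ne_one hΘlam
  have hY0 : Y ≠ 0 := by
    rw [hYdef, dualGen_def]
    exact mul_ne_zero (mul_ne_zero hhM (mul_ne_zero hx₀ ((map_ne_zero Θ).2 hx₀))) hcc
  have hD : Θ (cc * (α - ρ α) * Θ Y) = cc * (α - ρ α) * Θ Y := by
    rw [hYdef, dualGen_def]; simp only [map_mul, hΘΘ, hΘh]; ring
  have hΘcc0 : Θ cc * Θ (α - ρ α) ≠ 0 := by rw [← map_mul]; exact (map_ne_zero Θ).2 hcc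
  have hD0 : cc * (α - ρ α) * Θ Y ≠ 0 := by rw [cellScalar_eq_dualGen_mul hΘΘ hΘh cc x₀, ← hYdef]; exact mul_ne_zero hY0 hΘcc0
  -- the exact identity, rewritten through `D₀ = Y·Θcc·Θ(α − ρα)`
  rw [map_add_mul_map_eq σ jE hΘj hρj hΘρ hΘlam huu hD hD0 he₀]
  have hW : (lam - jE u) * (1 - lam⁻¹) / (cc * (α - ρ α) * Θ Y) = ((lam - jE u) / Y * (1 - lam⁻¹)) / (Θ cc * Θ (α - ρ α)) := by
    rw [cellScalar_eq_dualGen_mul hΘΘ hΘh cc x₀, ← hYdef]; field_simp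
  have hc' : ρ (Θ cc) = Θ cc := by rw [← hΘρ, hc]
  have hA : ρ (Θ (α - ρ α)) = -Θ (α - ρ α) := by rw [← hΘρ, map_sub ρ, hρρ, ← map_neg, neg_sub]
  rw [hW, add_map_div_eq_sub_map_div ρ hc' hA, map_div₀, Valuation.map_mul, hvΘ, hvΘ, ← Valuation.map_mul]
  -- the skew of the product `(μ∕Y)·(1 − lam⁻¹)`
  have hρlam : Valued.v (ρ lam) = 1 := by rw [hvρ, hvlam]
  have hV : Valued.v (1 - lam⁻¹) = Valued.v (lam - 1) := by
    have e : (1 : M) - lam⁻¹ = (lam - 1) * lam⁻¹ := by field_simp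
    rw [e, Valuation.map_mul, map_inv₀, hvlam, inv_one, mul_one]
  have hVρ : Valued.v ((1 - lam⁻¹) - ρ (1 - lam⁻¹)) = Valued.v (lam - ρ lam) := by
    rw [one_sub_inv_sub_map_eq ρ hlam0, map_div₀, Valuation.map_mul, hvlam, hρlam, mul_one, div_one]
  have hsk : Valued.v ((lam - jE u) / Y * (1 - lam⁻¹) - ρ ((lam - jE u) / Y * (1 - lam⁻¹))) ≤
      max (Valued.v (cc * (α - ρ α)) * Valued.v (lam - 1)) (Valued.v ((lam - jE u) / Y) * Valued.v (lam - ρ lam)) := by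
    rw [mul_sub_map_mul_eq ρ]
    refine (Valuation.map_add _ _ _).trans (max_le_max ?_ ?_)
    · rw [Valuation.map_mul, hV]; exact mul_le_mul' hP.2 le_rfl
    · rw [Valuation.map_mul, hvρ, hVρ]
  have hpos : (0 : ℤᵐ⁰) < Valued.v (cc * (α - ρ α)) := zero_lt_iff.2 ((Valuation.ne_zero_iff _).2 hcc)
  rw [div_le_iff₀ hpos, ← max_mul_mul_right, div_mul_cancel₀ _ hpos.ne', mul_comm (Valued.v (lam - 1))]
  exact hsk

omit [Valued E ℤᵐ⁰] in
/-- **THE SECOND TERM IN TOKENS**: `|μ| ≤ |jEϖ|^{m_E}`, `|Y| = |jEϖ|^b`, `|lam − ρlam| ≤ |jEϖ|^{jl}·|α − ρα|`, `cc = jEϖ^j`, `n + b + j ≤ m_E + jl`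
⟹ `|μ∕Y|·|lam − ρlam| ≤ |jEϖ|^n·|cc(α − ρα)|`. [cite: Serre1979, Ch. III §6 Prop. 12] -/
theorem v_skew_le_of_tokens (jE : E →+* M) {ϖ : E} (hjϖ0 : jE ϖ ≠ 0) (hjϖ1 : Valued.v (jE ϖ) ≤ 1) {μ Y sk A : M} {mE b jl j n : ℕ}
    (hμ : Valued.v μ ≤ Valued.v (jE ϖ) ^ mE) (hY : Valued.v Y = Valued.v (jE ϖ) ^ b) (hsk : Valued.v sk ≤ Valued.v (jE ϖ) ^ jl * Valued.v A)
    (hn : n + b + j ≤ mE + jl) :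
    Valued.v (μ / Y) * Valued.v sk ≤ Valued.v (jE ϖ) ^ n * Valued.v (jE ϖ ^ j * A) := by
  have hv0 : Valued.v (jE ϖ) ≠ 0 := (Valuation.ne_zero_iff _).2 hjϖ0
  have hYpos : (0 : ℤᵐ⁰) < Valued.v Y := by rw [hY]; exact pow_pos (zero_lt_iff.2 hv0) _
  rw [map_div₀, div_mul_eq_mul_div, div_le_iff₀ hYpos, hY, Valuation.map_mul, Valuation.map_pow]
  calc Valued.v μ * Valued.v sk ≤ Valued.v (jE ϖ) ^ mE * (Valued.v (jE ϖ) ^ jl * Valued.v A) := mul_le_mul' hμ hsk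
    _ = Valued.v (jE ϖ) ^ (mE + jl) * Valued.v A := by rw [pow_add, mul_assoc]
    _ ≤ Valued.v (jE ϖ) ^ (n + b + j) * Valued.v A := mul_le_mul' (pow_le_pow_right_of_le_one' hjϖ1 hn) le_rfl
    _ = Valued.v (jE ϖ) ^ n * (Valued.v (jE ϖ) ^ j * Valued.v A) * Valued.v (jE ϖ) ^ b := by
        simp only [pow_add, mul_assoc, mul_comm, mul_left_comm]

/-! ## §3 Transport to `E`: `|e₀ + σe₀|` from `|e₀ + u·σe₀|` and `|u − 1|`; the row reading `|e₀| = |ϖ|^{d%2}` -/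

/-- **`E`-SIDE**: `|jE(e₀ + u·σe₀)| ≤ |jEϖ|^n`, `|u − 1| ≤ |ϖ|^n`, `|e₀| ≤ 1`, `σ` isometric, `ϖ ≠ 0` ⟹ `|e₀ + σe₀| ≤ |ϖ|^n` (`e₀ + σe₀ = (e₀ + uσe₀) − (u − 1)σe₀`).
[cite: Serre1979, Ch. III §6 Prop. 12] -/
theorem v_add_map_le_of_map_le {σ : E →+* E} (hvσ : ∀ a, Valued.v (σ a) = Valued.v a) (jE : E →+* M) (hjv : ∀ c, Valued.v (jE c) ≤ 1 ↔ Valued.v c ≤ 1)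
    {ϖ : E} (hϖ0 : ϖ ≠ 0) {u e₀ : E} {n : ℕ} (h1 : Valued.v (jE (e₀ + u * σ e₀)) ≤ Valued.v (jE ϖ) ^ n)
    (hu1 : Valued.v (u - 1) ≤ Valued.v ϖ ^ n) (he1 : Valued.v e₀ ≤ 1) :
    Valued.v (e₀ + σ e₀) ≤ Valued.v ϖ ^ n := by
  have h1' : Valued.v (e₀ + u * σ e₀) ≤ Valued.v ϖ ^ n := (v_map_le_pow_iff jE hjv hϖ0 _ n).1 h1
  have e : e₀ + σ e₀ = (e₀ + u * σ e₀) - (u - 1) * σ e₀ := by ring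
  rw [e]
  refine (Valuation.map_sub _ _ _).trans (max_le h1' ?_)
  rw [Valuation.map_mul, hvσ]
  calc Valued.v (u - 1) * Valued.v e₀ ≤ Valued.v ϖ ^ n * 1 := mul_le_mul' hu1 he1
    _ = _ := mul_one _

/-- **THE ROW READING OF THE RAY SCALAR**: glue integrality `|pw + σg₁·h_W·g₁| ≤ 1`, `|ϖ^b g₁| = 1`, `|h_W| = 1`, the row token `|μ_a| = |ϖ|^{2b + d%2}` with `1 ≤ b`, and a
non-terminal boundary term `|μ_b·τ| < |ϖ|^{d%2}` ⟹ `|μ_a·pw + μ_b·τ| = |ϖ|^{d%2}` (`= |t₊|`). [cite: Jacobowitz1962, §4] [cite: Serre1979, Ch. V §3 Cor. 3] -/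
theorem v_rayScalar_eq_of_row (σ : E →+* E) (hvσ : ∀ a, Valued.v (σ a) = Valued.v a) {ϖ : E} (hϖ : Valued.v ϖ = exp (-1 : ℤ))
    {pw g₁ hW τ μa μb : E} {b d : ℕ} (hint : Valued.v (pw + σ g₁ * hW * g₁) ≤ 1) (hu : Valued.v (ϖ ^ b * g₁) = 1) (hh : Valued.v hW = 1)
    (hμav : Valued.v μa = Valued.v ϖ ^ (2 * b + d % 2)) (hb : 1 ≤ b) (hτ : Valued.v (μb * τ) < Valued.v ϖ ^ (d % 2)) :
    Valued.v (μa * pw + μb * τ) = Valued.v ϖ ^ (d % 2) := by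
  have hvϖ0 : Valued.v ϖ ≠ 0 := by rw [hϖ]; exact exp_ne_zero
  have hϖlt : Valued.v ϖ < 1 := by rw [hϖ, ← exp_zero, exp_lt_exp]; norm_num
  -- the line term: `|μ_a·σg₁ h_W g₁| = |ϖ|^{d%2}`
  have hX : Valued.v (μa * (σ g₁ * hW * g₁)) = Valued.v ϖ ^ (d % 2) := by
    have hu' : Valued.v (ϖ ^ b * σ g₁) = 1 := by rw [Valuation.map_mul, hvσ, ← Valuation.map_mul]; exact hu
    have e : μa * (σ g₁ * hW * g₁) * ϖ ^ (2 * b) = μa * hW * ((ϖ ^ b * g₁) * (ϖ ^ b * σ g₁)) := by ring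
    have h2 : Valued.v (μa * (σ g₁ * hW * g₁)) * Valued.v ϖ ^ (2 * b) = Valued.v ϖ ^ (d % 2) * Valued.v ϖ ^ (2 * b) := by
      rw [← Valuation.map_pow, ← Valuation.map_mul, e, Valuation.map_mul, Valuation.map_mul, Valuation.map_mul, hμav, hh, hu, hu',
        mul_one, mul_one, mul_one, Valuation.map_pow, ← pow_add]; congr 1; omega
    exact mul_right_cancel₀ (pow_ne_zero _ hvϖ0) h2
  have hmain : Valued.v (μa * pw) = Valued.v ϖ ^ (d % 2) := by
    have e : μa * pw = μa * (pw + σ g₁ * hW * g₁) - μa * (σ g₁ * hW * g₁) := by ring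
    have hlt : Valued.v (μa * (pw + σ g₁ * hW * g₁)) < Valued.v (μa * (σ g₁ * hW * g₁)) := by
      rw [hX, Valuation.map_mul, hμav]
      calc Valued.v ϖ ^ (2 * b + d % 2) * Valued.v (pw + σ g₁ * hW * g₁) ≤ Valued.v ϖ ^ (2 * b + d % 2) * 1 := by gcongr
        _ < Valued.v ϖ ^ (d % 2) := by
            rw [mul_one]; exact pow_lt_pow_right_of_lt_one₀ (zero_lt_iff.2 hvϖ0) hϖlt (by omega)
    rw [e, Valuation.map_sub_eq_of_lt_right _ hlt, hX]
  rw [← hmain] at hτ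
  rw [Valuation.map_add_eq_of_lt_left _ hτ, hmain]

/-! ## §4 HEAD — every non-terminal vertex of the live row is a `σ`-FIXED-UNIT ray at the modulus `m*` -/

/-- **HEAD — «THE RAY SCALAR OF A ROW VERTEX IS NEARLY `σ`-FIXED».**  ★ p861372 HEAD B's frame (plane `(E², H₂)`, block form `block(H₂, h_W)`, `Γ = endoGL (γ₂, u)`, ★ (C1)'s
line model, an integral vertex `L` glued over `(B₂, w₀)` with generator `g₀`, `Λ = x₀·𝒪_cc`, `φ w₀ = Y⁻¹x₀`) + ★ p861653's ray-domination letters at `m*` + the sheet datum on `E`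
+ `Θlam·lam = 1`, `|lam| = 1`, `u₀₀·σu₀₀ = 1`, the POPULATION token `μ∕Y ∈ 𝒪_cc` (★ DEFS `forall_herm_mul_mem_iff_isOrd_div`), the ray scalar `e₀ ∈ E` (`jE e₀ = Tr_ρ(μ∕D₀)`) ON the
`ℓ₀`-shell (`|e₀| = |ϖ|^{d%2}`, §3 `v_rayScalar_eq_of_row`) and three deep tokens at a level `n ≥ 3d − 2 + d%2`: `|lam − 1| ≤ |jEϖ|^n`, `|u₀₀ − 1| ≤ |ϖ|^n`,
`|μ∕Y|·|lam − ρlam| ≤ |jEϖ|^n·|cc(α − ρα)|` (§2 `v_skew_le_of_tokens`) ⟹ THERE IS a `σ`-fixed unit `e′` with `|e₀ − e′·t₊| ≤ |ϖ|^{m*}` and the `ϖ^{m*}`-value set of `Γ − 1` on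
`L` is `valueSetMod σ ϖ m* (e′ • X₊)` — CLEAN, FLIP and INTERMEDIATE cells alike. [cite: Jacobowitz1962, §4] [cite: Rogawski1990, §4.9 Prop. 4.9.1 (b) p. 55]
[cite: Kottwitz1986BaseChangeUnits, §1 pp. 240–241] [cite: Serre1979, Ch. I §6 Prop. 18; Ch. V §3 Cor. 3] -/
theorem exists_fixed_unit_valueSet_endoGL_sub_one_glued_eq_smul_xPlus {σ : E →+* E} {ϖ : E} {d t : ℕ} (hD : IsRamifiedQuadraticDatum σ ϖ d t)
    (H₂ : Matrix (Fin 2) (Fin 2) E) (h : E)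
    (jE : E →+* M) (hjv : ∀ c, Valued.v (jE c) ≤ 1 ↔ Valued.v c ≤ 1) (hjfix : ∀ z, ρ z = z ↔ ∃ c, jE c = z)
    (hρρ : ∀ x, ρ (ρ x) = x) (hvρ : ∀ x, Valued.v (ρ x) = Valued.v x) (hα : ρ α ≠ α) (hα1 : Valued.v α ≤ 1)
    (hintρ : ∀ z : M, Valued.v z ≤ 1 → Valued.v ((z - ρ z) / (α - ρ α)) ≤ 1)
    (hΘΘ : ∀ x, Θ (Θ x) = x) (hΘρ : ∀ x, Θ (ρ x) = ρ (Θ x)) (hvΘ : ∀ x, Valued.v (Θ x) = Valued.v x) (hΘj : ∀ c, Θ (jE c) = jE (σ c))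
    (φ : (Fin 2 → E) →+ M) (hφs : ∀ (c : E) (x : Fin 2 → E), φ (c • x) = jE c * φ x)
    {γ₂ : GL (Fin 2) E} {lam hM : M} (hφγ : ∀ x, φ ((γ₂ : Matrix (Fin 2) (Fin 2) E) *ᵥ x) = lam * φ x) (hhM : hM ≠ 0) (hΘh : Θ hM = hM)
    (hform : ∀ x y, jE (pairing σ H₂ x y) = hM * Θ (φ x) * φ y + ρ (hM * Θ (φ x) * φ y))
    {L : Submodule 𝒪[E] (Fin 3 → E)} {b : ℕ} (hpr : ∀ x ∈ L, Valued.v (x 1) * Valued.v ϖ ^ b ≤ 1)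
    (hint : ∀ y ∈ L, Valued.v (pairing σ (!![H₂ 0 0, 0, H₂ 0 1; 0, h, 0; H₂ 1 0, 0, H₂ 1 1] : Matrix (Fin 3) (Fin 3) E) y y) ≤ 1)
    {B₂ : Submodule 𝒪[E] (Fin 2 → E)} {w₀ : Fin 2 → E} {g₀ : Fin 3 → E}
    (hB : B₂.map ((Matrix.toLin' (!![1, 0; 0, 0; 0, 1] : Matrix (Fin 3) (Fin 2) E)).restrictScalars 𝒪[E]) =
      L ⊓ LinearMap.ker ((LinearMap.proj (1 : Fin 3) : (Fin 3 → E) →ₗ[E] E).restrictScalars 𝒪[E]))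
    (hg₀ : g₀ ∈ L) (hg₀1 : Valued.v (g₀ 1) * Valued.v ϖ ^ b = 1) (hprg : g₀ - Pi.single 1 (g₀ 1) = ![w₀ 0, 0, w₀ 1])
    (u : GL (Fin 1) E)
    {cc x₀ : M} (hc : ρ cc = cc) (hc0 : cc ≠ 0) (hc1 : Valued.v cc ≤ 1) (hcc : cc * (α - ρ α) ≠ 0) (hx₀ : x₀ ≠ 0)
    {Λ : AddSubgroup M} (hBΛ : B₂.toAddSubgroup.map φ = Λ)
    (hΛx : ∀ x, x ∈ Λ ↔ ∃ ζ, IsOrd ρ α cc ζ ∧ x = x₀ * ζ) (hw₀Y : φ w₀ = (dualGen ρ Θ α cc hM x₀)⁻¹ * x₀)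
    -- the ray-domination letters (★ p861653) at the modulus `m*`
    (hYO : IsOrd ρ α cc (dualGen ρ Θ α cc hM x₀))
    {μt : M} {m' : ℕ} (hμ : lam - jE ((u : Matrix (Fin 1) (Fin 1) E) 0 0) = jE (ϖ ^ m') * μt) (hμt : IsOrd ρ α cc μt) (hmm : mstarOfRecord d ≤ m')
    -- the line-model structure, the population token, the ray scalar on the `ℓ₀`-shell, the three deep tokens
    (hΘlam : Θ lam * lam = 1) (hvlam : Valued.v lam = 1)
    (huu : ((u : Matrix (Fin 1) (Fin 1) E) 0 0) * σ ((u : Matrix (Fin 1) (Fin 1) E) 0 0) = 1)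
    (hP : IsOrd ρ α cc ((lam - jE ((u : Matrix (Fin 1) (Fin 1) E) 0 0)) / dualGen ρ Θ α cc hM x₀))
    {e₀ : E} (he₀ : jE e₀ = (lam - jE ((u : Matrix (Fin 1) (Fin 1) E) 0 0)) / (cc * (α - ρ α) * Θ (dualGen ρ Θ α cc hM x₀)) +
      ρ ((lam - jE ((u : Matrix (Fin 1) (Fin 1) E) 0 0)) / (cc * (α - ρ α) * Θ (dualGen ρ Θ α cc hM x₀))))
    (he₀v : Valued.v e₀ = Valued.v ϖ ^ (d % 2)) {n : ℕ} (hn : 3 * d - 2 + d % 2 ≤ n)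
    (hlamn : Valued.v (lam - 1) ≤ Valued.v (jE ϖ) ^ n) (hun : Valued.v ((u : Matrix (Fin 1) (Fin 1) E) 0 0 - 1) ≤ Valued.v ϖ ^ n)
    (hsk : Valued.v ((lam - jE ((u : Matrix (Fin 1) (Fin 1) E) 0 0)) / dualGen ρ Θ α cc hM x₀) * Valued.v (lam - ρ lam) ≤
      Valued.v (jE ϖ) ^ n * Valued.v (cc * (α - ρ α))) :
    ∃ e' : E, σ e' = e' ∧ Valued.v e' = 1 ∧
      Valued.v (e₀ - e' * ((ϖ - σ ϖ) * ((ϖ * σ ϖ) ^ ((d - d % 2) / 2))⁻¹)) ≤ Valued.v ϖ ^ mstarOfRecord d ∧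
      {z : E | ∃ y ∈ L, Valued.v ((ϖ ^ mstarOfRecord d)⁻¹ * (z - pairing σ (!![H₂ 0 0, 0, H₂ 0 1; 0, h, 0; H₂ 1 0, 0, H₂ 1 1] : Matrix (Fin 3) (Fin 3) E) y
          ((((endoGL (γ₂, u) : GL (Fin 3) E) : Matrix (Fin 3) (Fin 3) E) - 1) *ᵥ y))) ≤ 1} =
        valueSetMod σ ϖ (mstarOfRecord d) (e' • xPlus σ ϖ d) := by
  obtain ⟨hσσ, hvσ, hϖ, -, hd, hd1, -⟩ := id hD
  have hvϖ0 : Valued.v ϖ ≠ 0 := by rw [hϖ]; exact exp_ne_zero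
  have hϖ0 : ϖ ≠ 0 := fun h0 => by rw [h0, map_zero] at hvϖ0; exact hvϖ0 rfl
  have hϖ1 : Valued.v ϖ ≤ 1 := by rw [hϖ, ← exp_zero, exp_le_exp]; norm_num
  have hm : mstarOfRecord d = d % 2 + 2 * d - 1 := rfl
  have hρj : ∀ c : E, ρ (jE c) = jE c := fun c => (hjfix _).2 ⟨c, rfl⟩
  -- Step A: `|e₀ + σe₀| ≤ |ϖ|^n`
  have hpos : (0 : ℤᵐ⁰) < Valued.v (cc * (α - ρ α)) := zero_lt_iff.2 ((Valuation.ne_zero_iff _).2 hcc)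
  have hMside := v_map_add_mul_map_le σ jE hΘj hρj hρρ hvρ hΘΘ hΘρ hvΘ hc hcc hhM hΘh hx₀ hΘlam hvlam huu hP he₀
  have hMn : Valued.v (jE (e₀ + ((u : Matrix (Fin 1) (Fin 1) E) 0 0) * σ e₀)) ≤ Valued.v (jE ϖ) ^ n :=
    hMside.trans (max_le hlamn ((div_le_iff₀ hpos).2 hsk))
  have hE : Valued.v (e₀ + σ e₀) ≤ Valued.v ϖ ^ n := v_add_map_le_of_map_le hvσ jE hjv hϖ0 hMn hun (by
    rw [he₀v]; exact pow_le_one₀ zero_le hϖ1)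
  -- Step B: Eisenstein coordinates — the fixed unit `e′` at precision `(2d − 1) + d%2 = m*`
  obtain ⟨e', he'σ, he'1, hclose⟩ := exists_fixed_unit_sub_mul_refSkew_le_any hD (N := 2 * d - 1) (by omega) he₀v
    (hE.trans (pow_le_pow_right_of_le_one' hϖ1 (by omega)))
  have hclose' : Valued.v (e₀ - e' * ((ϖ - σ ϖ) * ((ϖ * σ ϖ) ^ ((d - d % 2) / 2))⁻¹)) ≤ Valued.v ϖ ^ mstarOfRecord d :=
    hclose.trans (le_of_eq (by rw [hm]; congr 1; omega))
  refine ⟨e', he'σ, he'1, hclose', ?_⟩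
  -- Step C: HEAD B, ★ p861653, (S0″)
  have hum : Valued.v ((u : Matrix (Fin 1) (Fin 1) E) 0 0 - 1) ≤ Valued.v (ϖ ^ mstarOfRecord d) := by
    rw [Valuation.map_pow]; exact hun.trans (pow_le_pow_right_of_le_one' hϖ1 (by rw [hm]; omega))
  rw [valueSet_endoGL_sub_one_glued_eq_normFormSet_of_gen σ hϖ H₂ h jE hjv hΘΘ φ hφs hφγ hhM hform hpr hint hB hg₀ hg₀1 hprg u (mstarOfRecord d) hum hcc hx₀ hBΛ hΛx hw₀Y]
  simp_rw [mul_div_right_comm (lam - jE ((u : Matrix (Fin 1) (Fin 1) E) 0 0))]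
  rw [normFormSet_eq_ray_of_isOrd hρρ hvρ hα hα1 hintρ hΘΘ hΘρ hvΘ hc hc0 hc1 hcc hhM hΘh hx₀ hΛx hYO hvσ hϖ hd jE hjv hΘj hjfix hμ hμt hmm he₀]
  -- `|e₀∕t₊ − e′| ≤ |ϖ|^{2d−1}`
  have hvt : Valued.v ((ϖ - σ ϖ) * ((ϖ * σ ϖ) ^ ((d - d % 2) / 2))⁻¹) = Valued.v ϖ ^ (d % 2) := v_refSkew_eq hvσ hϖ hd
  set tp : E := (ϖ - σ ϖ) * ((ϖ * σ ϖ) ^ ((d - d % 2) / 2))⁻¹ with htp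
  have htp0 : tp ≠ 0 := fun h0 => by rw [h0, map_zero] at hvt; exact pow_ne_zero _ hvϖ0 hvt.symm
  have hge : Valued.v (e₀ * tp⁻¹ - e') ≤ Valued.v ϖ ^ (2 * d - 1) := by
    have e : e₀ * tp⁻¹ - e' = tp⁻¹ * (e₀ - e' * tp) := by field_simp
    rw [e, Valuation.map_mul, map_inv₀, hvt, inv_mul_le_iff₀ (pow_pos (zero_lt_iff.2 hvϖ0) _), ← pow_add]
    exact hclose.trans (le_of_eq (by rw [add_comm]))
  exact valueSetMod_smul_xPlus_eq_of_v_sub_le_pred hvσ hϖ hd (show mstarOfRecord d ≤ (2 * d - 1) + d % 2 from by rw [hm]; omega) hge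

end Summit.HodgeConjecture.HodgeConjecture.Cruxes.H413.F0P3cDyRamRayScalarNearlyFixed

end
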